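import Mathlib
import HarnessLib
import Literature.Analysis.FluidPDE.Tao2016AveragedNS.LocalCascadeSolutions
import Literature.Analysis.FluidPDE.Tao2016AveragedNS.RenormalisedCascadeWaves
import Literature.Analysis.FluidPDE.Tao2016AveragedNS.ViscousEternalSolutions
import Literature.Analysis.FluidPDE.Tao2016AveragedNS.SelfSimilarCascadeBlowup
import Literature.Analysis.FluidPDE.Tao2016AveragedNS.BoundedEternalSolutions
import Summits.NavierStokesRegularity.NavierStokesRegularity.Theorems.TaoLadderRungTwoBreakNoSurvivingEternalViscBddOneSurvivalLoudVisc
import Summits.NavierStokesRegularity.NavierStokesRegularity.Theorems.TaoLadderRungTwoBreakNoSurvivingDSSOneLeadingEdge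

/-!
# Cruxes ⟨20419⟩ `NoSurvivingEternalViscBddOne` and ⟨20205⟩ `NoSurvivingDSSOne` (route TaoLadderRungTwoBreak):
# (S₁)-SURVIVAL IS FREQUENTLY LOUD for every `ν̂ ≥ 0` and every cancelling table; under a quiet past it is LOUD ON
# EVERY SHELL; every (S₁)-surviving admissible DSS wave is loud on every profile of the orbit of a lit profile

MODEL lattice ODEs only (Tao 2016 §4 in the self-similar log-time variables of §6.4); nothing in this file
is a statement about the Navier–Stokes equations, and no summit or rung LEAF is proved by it
(`--supports stmt-NavierStokesRegularity-20419 --as helper`).  `C_A = fluxConst α`, `Λ = bigLam ε₀`,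
`q₀ = 1/(4Λ(C_A+1))`.

`…SurvivalLoudVisc.not_survivingFwd_of_neverLoud_tail` holds for EVERY `ν̂ ≥ 0`; the viscosity was used only to
discharge the quiet past in the loud down-set.  Hence:

* `survivingFwd_frequently_loud` — any `ν̂ ≥ 0`, any cancelling table, uniformly bounded admissible eternal solution:
  (S₁)-survival ⇒ beyond every shell there is a shell exceeding `q₀` at some log-time (the AMPLITUDE companion of
  the tree's «infinitely many expensive bonds», `…TailConveyor`).
* `loud_downset_of_quietPast`, `survivingFwd_loud_everywhere_of_quietPast` — if every tail was quiet at level `q₀` in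
  some past (the one hypothesis of the inviscid tail barrier), the loud set is a down-set and (S₁)-survival lights
  EVERY shell.
* `dss_surviving_orbit_loud` — BY NAME on ⟨20205⟩'s binders, for EVERY cancelling table: an admissible DSS wave
  (`IsDSSWave`) that is (S₁)-surviving (`Surviving 1 ε₀ T`) reaches amplitude `> q₀` on every profile of the
  `π`-orbit of a lit profile (the quiet past is automatic on the DSS stratum, `dss_exists_quietPast`) — the level
  `q₀` does not depend on the wave's mass, delay or `ε₀`-smallness.

HONEST LABEL: structure lemmas; the stubs of ⟨20419⟩/⟨20205⟩ stay OPEN; rung 0.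
-/

noncomputable section

-- the summit and its single sub-problem share the name (CONVENTIONS §1)
set_option linter.dupNamespace false

namespace Summit.NavierStokesRegularity.NavierStokesRegularity.Theorems.NoSurvivingEternalViscBddOne.TailBarrier

open Set Filter Topology MeasureTheory
open scoped RealInnerProductSpace
open Literature.Analysis.FluidPDE Literature.Analysis.FluidPDE.TaoCascade
open Summit.NavierStokesRegularity.NavierStokesRegularity.Theorems.NoSurvivingDSSOne.LeadingEdge
  (dss_exists_quietPast)

variable {m : ℕ} {ε₀ νh : ℝ} {α : Fin m → Fin m → Fin m → ℤ × ℤ × ℤ → ℝ} {W : ℤ → ℝ → Em m}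

/-- **(S₁)-survival is frequently loud** (any `ν̂ ≥ 0`, any cancelling table): a uniformly bounded admissible eternal
solution that is forward (S₁)-surviving has, beyond every shell `k`, a shell `j ≥ k` exceeding `q₀ = 1/(4Λ(C_A+1))`
at some log-time.
[cite: Tao2016AveragedNS, §4 Thm. 4.2 (statement shape), Lemma 4.1 (4.8)–(4.10); §6.4] -/
theorem survivingFwd_frequently_loud (hε : 0 < ε₀) (hW : IsEternalVisc ε₀ νh α W) (hc : IsCancellingCoeff α)
    (hU : UniformBound W) (hS : EternalSurvivingFwd 1 ε₀ W) (k : ℤ) :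
    ∃ j : ℤ, k ≤ j ∧ ∃ s : ℝ, 1 / (4 * bigLam ε₀ * (fluxConst α + 1)) < ‖W j s‖ := by
  by_contra h
  push Not at h
  exact not_survivingFwd_of_neverLoud_tail hε hW hc hU (k := k) (fun j hj s => h j hj s) hS

/-- **The loud set is a down-set under a quiet past** (any `ν̂ ≥ 0`): if every tail `j ≥ n` of a uniformly bounded
admissible eternal solution of a cancelling table was quiet at level `q₀` on some `(-∞, σ₀(n)]`, then loudness of shell
`k` by `σ₁` forces loudness of every shell `j ≤ k` by `σ₁`.
[cite: Tao2016AveragedNS, §4 (4.1), (4.3), Lemma 4.1 (4.8); §5; §6.4] -/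
theorem loud_downset_of_quietPast (hε : 0 < ε₀) (hW : IsEternalVisc ε₀ νh α W) (hc : IsCancellingCoeff α)
    (hU : UniformBound W)
    (hpast : ∀ n : ℤ, ∃ σ₀ : ℝ, ∀ j : ℤ, n ≤ j → ∀ s, s ≤ σ₀ →
      ‖W j s‖ ≤ 1 / (4 * bigLam ε₀ * (fluxConst α + 1)))
    {k : ℤ} {σ₁ s : ℝ} (hs : s ≤ σ₁) (hloud : 1 / (4 * bigLam ε₀ * (fluxConst α + 1)) < ‖W k s‖) :
    ∀ j : ℤ, j ≤ k → ∃ s', s' ≤ σ₁ ∧ 1 / (4 * bigLam ε₀ * (fluxConst α + 1)) < ‖W j s'‖ := by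
  have hΛ1 : 1 ≤ bigLam ε₀ := one_le_bigLam hε.le
  have hΛ : 0 < bigLam ε₀ := by linarith
  have hCA : 0 ≤ fluxConst α := fluxConst_nonneg α
  set q : ℝ := 1 / (4 * bigLam ε₀ * (fluxConst α + 1)) with hq
  have hq0 : 0 < q := by rw [hq]; positivity
  have hqd : q * (4 * bigLam ε₀ * (fluxConst α + 1)) = 1 := by rw [hq]; field_simp
  have hq4 : 4 * fluxConst α * q ≤ bigLam ε₀ := by
    have h1 : 4 * fluxConst α * q ≤ 4 * (fluxConst α + 1) * bigLam ε₀ * q := by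
      have : fluxConst α ≤ (fluxConst α + 1) * bigLam ε₀ := by nlinarith
      nlinarith
    have h2 : 4 * (fluxConst α + 1) * bigLam ε₀ * q = 1 := by linarith [hqd]
    linarith
  have hq2 : 2 * bigLam ε₀ * fluxConst α * q ^ 2 < q := by
    have h1 : 2 * bigLam ε₀ * fluxConst α * q < 1 := by nlinarith [mul_pos hΛ hq0]
    nlinarith
  suffices H : ∀ d : ℕ, ∀ j : ℤ, j = k - d → ∃ s', s' ≤ σ₁ ∧ q < ‖W j s'‖ by
    intro j hj
    obtain ⟨d, hd⟩ : ∃ d : ℕ, j = k - d := ⟨(k - j).toNat, by omega⟩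
    exact H d j hd
  intro d
  induction d with
  | zero =>
    intro j hj
    simp only [Nat.cast_zero, sub_zero] at hj
    subst hj
    exact ⟨s, hs, hloud⟩
  | succ d ih =>
    intro j hj
    obtain ⟨s', hs', hloud'⟩ := ih (k - d) rfl
    have hjn : j = (k - d) - 1 := by rw [hj]; push_cast; ring
    obtain ⟨σ₀, hσ₀⟩ := hpast (k - d)
    have h0 : ∀ k' : ℤ, k - d ≤ k' → ∀ t, t ≤ min σ₀ s' → ‖W k' t‖ ≤ q :=
      fun k' hk' t ht => hσ₀ k' hk' t (ht.trans (min_le_left _ _))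
    obtain ⟨s'', hs'', h''⟩ := orderedIgnition_of_quietPast hε hW hc hU (min_le_right σ₀ s') hq4 hq2 h0
      (le_refl (k - (d : ℤ))) le_rfl hloud' hq2
    exact ⟨s'', hs''.trans hs', by rw [hjn]; exact h''⟩

/-- **Under a quiet past, (S₁)-survival is loud on every shell** (any `ν̂ ≥ 0`, any cancelling table).
[cite: Tao2016AveragedNS, §4 Thm. 4.2 (statement shape), Lemma 4.1 (4.8)–(4.10); §6.4] -/
theorem survivingFwd_loud_everywhere_of_quietPast (hε : 0 < ε₀) (hW : IsEternalVisc ε₀ νh α W)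
    (hc : IsCancellingCoeff α) (hU : UniformBound W)
    (hpast : ∀ n : ℤ, ∃ σ₀ : ℝ, ∀ j : ℤ, n ≤ j → ∀ s, s ≤ σ₀ →
      ‖W j s‖ ≤ 1 / (4 * bigLam ε₀ * (fluxConst α + 1)))
    (hS : EternalSurvivingFwd 1 ε₀ W) :
    ∀ j : ℤ, ∃ s : ℝ, 1 / (4 * bigLam ε₀ * (fluxConst α + 1)) < ‖W j s‖ := by
  intro j
  obtain ⟨k, hjk, s, hs⟩ := survivingFwd_frequently_loud hε hW hc hU hS j
  obtain ⟨s', -, hs'⟩ := loud_downset_of_quietPast hε hW hc hU hpast (σ₁ := s) le_rfl hs j hjk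
  exact ⟨s', hs'⟩

/-- **BY NAME on ⟨20205⟩'s binders, every cancelling table: an (S₁)-surviving admissible DSS wave is loud on every
profile of the orbit of a lit profile.**  If `IsDSSWave ε₀ α π T Φ` (`ε₀ > 0`), `Surviving 1 ε₀ T` and
`Φ_{r₀}(x₀) ≠ 0`, then for every `j : ℤ` the profile `π^j r₀` exceeds `q₀ = 1/(4Λ(C_A+1))` at some point.
[cite: Tao2016AveragedNS, §4 Lemma 4.1 (4.8), Thm. 4.2 (statement shape), §6.4; cell predicates `IsDSSWave`, `Surviving`] -/
theorem dss_surviving_orbit_loud {ρ : Type*} [Fintype ρ] {π : Equiv.Perm ρ} {T : ℝ} {Φ : ρ → ℝ → Em m}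
    (hε : 0 < ε₀) (hW : IsDSSWave ε₀ α π T Φ) (hc : IsCancellingCoeff α) (hS : Surviving 1 ε₀ T)
    {r₀ : ρ} {x₀ : ℝ} (hne : Φ r₀ x₀ ≠ 0) :
    ∀ j : ℤ, ∃ x : ℝ, 1 / (4 * bigLam ε₀ * (fluxConst α + 1)) < ‖Φ ((π ^ j) r₀) x‖ := by
  have hE : IsEternalVisc ε₀ 0 α (dssEmbed π T Φ r₀) := (hW.isEternal_dssEmbed r₀).isEternalVisc
  have hU : UniformBound (dssEmbed π T Φ r₀) := uniformBound_dssEmbed hW r₀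
  have hSurv : EternalSurvivingFwd 1 ε₀ (dssEmbed π T Φ r₀) :=
    eternalSurvivingFwd_dssEmbed hε hW.delay_pos hS hne
  have hΛ : 0 < bigLam ε₀ := bigLam_pos (by linarith)
  have hCA : 0 ≤ fluxConst α := fluxConst_nonneg α
  have hq0 : 0 < 1 / (4 * bigLam ε₀ * (fluxConst α + 1)) := by positivity
  have hpast : ∀ n : ℤ, ∃ σ₀ : ℝ, ∀ j : ℤ, n ≤ j → ∀ s, s ≤ σ₀ →
      ‖dssEmbed π T Φ r₀ j s‖ ≤ 1 / (4 * bigLam ε₀ * (fluxConst α + 1)) :=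
    fun n => dss_exists_quietPast hε hW r₀ n hq0
  intro j
  obtain ⟨s, hs⟩ := survivingFwd_loud_everywhere_of_quietPast hε hE hc hU hpast hSurv j
  exact ⟨s - j * T, by simpa only [dssEmbed] using hs⟩

end Summit.NavierStokesRegularity.NavierStokesRegularity.Theorems.NoSurvivingEternalViscBddOne.TailBarrier

end
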